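import Summits.KontsevichZagierPeriods.KontsevichZagierPeriods.Theorems.TerasomaMultiplicationBetaCancellationStubEquivalentOfAEJacobian
import Literature.NumberTheory.Transcendental.KZLogCalculusProofs
import Literature.NumberTheory.Transcendental.SemialgebraicMapsProofs
import Mathlib.Analysis.Calculus.InverseFunctionTheorem.FDeriv

/-!
# Semialgebraic injective differentiable maps invert off a null semialgebraic set

Helper for the one-bijection normal form (`stub_tameForm`) of line `divisor-slicing-transshipment`
of crux `BetaCancellation` (stmt-KontsevichZagierPeriods-13633): the INVERSE of a rule-(2)
substitution is again rule-(2) data on a co-null open semialgebraic part of the image.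

If `Φ` is `ℚ`-semialgebraic and injective on a `ℚ`-semialgebraic `S ⊆ ℝᵈ`, differentiable within
`S` with derivatives `Φ' z` of non-zero determinant, then there is an OPEN `ℚ`-semialgebraic
`T ⊆ S` with `S ∖ T` semialgebraic and null such that `Φ '' T` is open and semialgebraic,
`Φ '' S ∖ Φ '' T` is null, `Φ` is strictly differentiable on `T`, and the inverse
`Function.invFunOn Φ S` is `ℚ`-semialgebraic on `Φ '' T` and strictly differentiable there with
derivative `(Φ' z)⁻¹` at `Φ z`. Ingredients: `exists_isOpen_contDiffOn` (a semialgebraic function is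
`C^∞` off a null semialgebraic set, BCR §2.9), Mathlib's inverse function theorem
(`HasStrictFDerivAt.to_local_left_inverse`, `map_nhds_eq_of_equiv`), the area inequality for images
of null sets (`aeJacobian_volume_image_null`).
-/

noncomputable section

set_option linter.dupNamespace false

open MeasureTheory Set Filter Function
open scoped Topology ContDiff
open Literature.NumberTheory.Transcendental
open Literature.NumberTheory.Transcendental.KZ
open Literature.ModelTheory.ExponentialFields (IsSemialgebraic)

namespace Summit.KontsevichZagierPeriods.KontsevichZagierPeriods.BetaCancellationDivisorSlicing

variable {d : ℕ}

/-- Precomposition with the block flip `finAddFlip : Fin (d + d) ≃ Fin (d + d)` exchanges the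
two halves of `Fin.append`. [folklore] -/
theorem append_comp_finAddFlip (x y : Fin d → ℝ) :
    (Fin.append y x) ∘ (finAddFlip : Fin (d + d) ≃ Fin (d + d)) = Fin.append x y := by
  ext i
  refine Fin.addCases (fun i => ?_) (fun j => ?_) i
  · rw [Function.comp_apply, finAddFlip_apply_castAdd, Fin.append_right, Fin.append_left]
  · rw [Function.comp_apply, finAddFlip_apply_natAdd, Fin.append_left, Fin.append_right]

/-- The block flip on `Fin (d + d)` is an involution. [folklore] -/
theorem finAddFlip_comp_finAddFlip :
    ((finAddFlip : Fin (d + d) ≃ Fin (d + d)) : Fin (d + d) → Fin (d + d)) ∘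
      (finAddFlip : Fin (d + d) ≃ Fin (d + d)) = id := by
  funext i
  refine Fin.addCases (fun i => ?_) (fun j => ?_) i
  · rw [Function.comp_apply, finAddFlip_apply_castAdd, finAddFlip_apply_natAdd]; rfl
  · rw [Function.comp_apply, finAddFlip_apply_natAdd, finAddFlip_apply_castAdd]; rfl

/-- **The inverse of an injective semialgebraic map is semialgebraic** on the image of any
semialgebraic `T ⊆ S`: its graph is the block flip (`finAddFlip`) of the graph of `Φ|_T`.
[Bochnak–Coste–Roy 1998, Prop. 2.2.7] [folklore] -/
theorem isSemialgebraicMapOn_invFunOn {S T : Set (Fin d → ℝ)} {Φ : (Fin d → ℝ) → (Fin d → ℝ)}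
    (hΦ : IsSemialgebraicMapOn ℚ S Φ) (hinj : InjOn Φ S) (hTS : T ⊆ S)
    (hT : IsSemialgebraic ℚ T) :
    IsSemialgebraicMapOn ℚ (Φ '' T) (invFunOn Φ S) := by
  have hΦT : IsSemialgebraicMapOn ℚ T Φ := hΦ.mono hTS hT
  have hpre := Literature.ModelTheory.ExponentialFields.IsSemialgebraic.preimage_comp
    (R := ℝ) ((finAddFlip : Fin (d + d) ≃ Fin (d + d)) : Fin (d + d) → Fin (d + d)) hΦT
  unfold IsSemialgebraicMapOn
  convert hpre using 1
  ext z
  simp only [mem_setOf_eq, mem_preimage]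
  constructor
  · rintro ⟨y, ⟨x, hxT, rfl⟩, rfl⟩
    refine ⟨x, hxT, ?_⟩
    rw [append_comp_finAddFlip, hinj.leftInvOn_invFunOn (hTS hxT)]
  · rintro ⟨x, hxT, hx⟩
    refine ⟨Φ x, ⟨x, hxT, rfl⟩, ?_⟩
    have hz : z = (Fin.append x (Φ x)) ∘ (finAddFlip : Fin (d + d) ≃ Fin (d + d)) := by
      have h := congrArg
        (fun w : Fin (d + d) → ℝ => w ∘ (finAddFlip : Fin (d + d) ≃ Fin (d + d))) hx
      simpa [Function.comp_assoc, finAddFlip_comp_finAddFlip] using h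
    rw [hz, hinj.leftInvOn_invFunOn (hTS hxT)]
    exact append_comp_finAddFlip (Φ x) x

/-- **Inversion of a rule-(2) substitution off a null semialgebraic set.** [folklore] -/
theorem exists_open_semialgebraic_inverse' {S : Set (Fin d → ℝ)} {Φ : (Fin d → ℝ) → (Fin d → ℝ)}
    {Φ' : (Fin d → ℝ) → (Fin d → ℝ) →L[ℝ] (Fin d → ℝ)}
    (hS : IsSemialgebraic ℚ S) (hΦ : IsSemialgebraicMapOn ℚ S Φ) (hinj : InjOn Φ S)
    (hderiv : ∀ z ∈ S, HasFDerivWithinAt Φ (Φ' z) S z) (hdet : ∀ z ∈ S, (Φ' z).det ≠ 0) :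
    ∃ T : Set (Fin d → ℝ), T ⊆ S ∧ IsOpen T ∧ IsSemialgebraic ℚ T ∧ IsSemialgebraic ℚ (S \ T) ∧
      volume (S \ T) = 0 ∧ IsOpen (Φ '' T) ∧ IsSemialgebraic ℚ (Φ '' T) ∧
      volume (Φ '' S \ Φ '' T) = 0 ∧
      IsSemialgebraicMapOn ℚ (Φ '' T) (invFunOn Φ S) ∧
      (∀ z ∈ T, invFunOn Φ S (Φ z) = z) ∧
      (∀ z ∈ T, HasStrictFDerivAt Φ (Φ' z) z) ∧
      (∀ z (hz : z ∈ S), z ∈ T → HasStrictFDerivAt (invFunOn Φ S)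
        (((Φ' z).toContinuousLinearEquivOfDetNeZero (hdet z hz)).symm : (Fin d → ℝ) →L[ℝ] (Fin d → ℝ))
        (Φ z)) := by
  -- semialgebraicity of the components and their smooth loci
  have hcomp : ∀ j, IsSemialgebraicFunOn ℚ S (fun z => Φ z j) :=
    (isSemialgebraicMapOn_iff_forall_holds (k := ℚ) hS).1 hΦ
  choose G hGS hGo hGsa hGc hGdsa hGnull using fun j => exists_isOpen_contDiffOn hS (hcomp j)
  set T : Set (Fin d → ℝ) := S ∩ ⋂ j, G j with hT_def
  have hTS : T ⊆ S := inter_subset_left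
  -- `T` is open: in positive dimension it is the finite intersection of the open `G j`
  have hTo : IsOpen T := by
    rcases isEmpty_or_nonempty (Fin d) with h | ⟨⟨j₀⟩⟩
    · haveI : Subsingleton (Fin d → ℝ) := inferInstance
      rcases T.eq_empty_or_nonempty with hTe | hTn
      · rw [hTe]; exact isOpen_empty
      · rw [Subsingleton.eq_univ_of_nonempty hTn]; exact isOpen_univ
    · have : T = ⋂ j, G j := by
        refine Subset.antisymm inter_subset_right fun z hz => ⟨hGS j₀ (mem_iInter.1 hz j₀), hz⟩
      rw [this]
      exact isOpen_iInter_of_finite hGo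
  have hTsa : IsSemialgebraic ℚ T := by
    refine hS.inter ?_
    rcases isEmpty_or_nonempty (Fin d) with h | ⟨⟨j₀⟩⟩
    · have : (⋂ j, G j : Set (Fin d → ℝ)) = univ := by
        ext z; simp only [mem_iInter, mem_univ, iff_true]; exact fun j => (h.false j).elim
      rw [this]; exact Literature.ModelTheory.ExponentialFields.isSemialgebraic_univ
    · have h := Literature.ModelTheory.ExponentialFields.IsSemialgebraic.biInter (k := ℚ)
        (Finset.univ : Finset (Fin d)) G (fun j _ => hGsa j)
      simpa using h
  -- `S ∖ T` is the finite union of the null semialgebraic `S ∖ G j`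
  have hST : S \ T = ⋃ j, (S \ G j) := by
    ext z
    constructor
    · rintro ⟨hzS, hzT⟩
      have h : ¬ ∀ j, z ∈ G j := fun h => hzT ⟨hzS, mem_iInter.2 h⟩
      push Not at h
      obtain ⟨j, hj⟩ := h
      exact mem_iUnion.2 ⟨j, hzS, hj⟩
    · intro hz
      obtain ⟨j, hj⟩ := mem_iUnion.1 hz
      exact ⟨hj.1, fun hT => hj.2 (mem_iInter.1 hT.2 j)⟩
  have hSTsa : IsSemialgebraic ℚ (S \ T) := hS.diff hTsa
  have hSTnull : volume (S \ T) = 0 := by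
    rw [hST]
    exact measure_iUnion_null fun j => hGnull j
  -- smoothness of `Φ` on `T`, strict derivatives `Φ' z`
  have hΦsm : ContDiffOn ℝ ∞ Φ T := by
    rw [contDiffOn_pi]
    intro j
    exact (hGc j).mono (fun z hz => mem_iInter.1 hz.2 j)
  have hstrict : ∀ z ∈ T, HasStrictFDerivAt Φ (Φ' z) z := by
    intro z hz
    have hT𝓝 : T ∈ 𝓝 z := hTo.mem_nhds hz
    have hS𝓝 : S ∈ 𝓝 z := mem_of_superset hT𝓝 hTS
    have hd : HasFDerivAt Φ (Φ' z) z := (hderiv z (hTS hz)).hasFDerivAt hS𝓝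
    have hc : ContDiffAt ℝ ∞ Φ z := hΦsm.contDiffAt hT𝓝
    have := hc.hasStrictFDerivAt (by simp)
    rwa [hd.fderiv] at this
  -- the equivalences and the strict derivative of the inverse
  have hstrictE : ∀ z (hz : z ∈ S), z ∈ T → HasStrictFDerivAt Φ
      (((Φ' z).toContinuousLinearEquivOfDetNeZero (hdet z hz) : (Fin d → ℝ) →L[ℝ] (Fin d → ℝ))) z := by
    intro z hz hzT
    rw [ContinuousLinearMap.coe_toContinuousLinearEquivOfDetNeZero]
    exact hstrict z hzT
  have hleft : ∀ z ∈ T, invFunOn Φ S (Φ z) = z := fun z hz => hinj.leftInvOn_invFunOn (hTS hz)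
  have hinv : ∀ z (hz : z ∈ S), z ∈ T → HasStrictFDerivAt (invFunOn Φ S)
      (((Φ' z).toContinuousLinearEquivOfDetNeZero (hdet z hz)).symm : (Fin d → ℝ) →L[ℝ] (Fin d → ℝ))
      (Φ z) := by
    intro z hz hzT
    refine (hstrictE z hz hzT).to_local_left_inverse ?_
    filter_upwards [hTo.mem_nhds hzT] with x hx using hleft x hx
  -- the image `Φ '' T` is open (local surjectivity of the inverse function theorem)
  have hopen : IsOpen (Φ '' T) := by
    rw [isOpen_iff_mem_nhds]
    rintro y ⟨z, hzT, rfl⟩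
    have hmap := (hstrictE z (hTS hzT) hzT).map_nhds_eq_of_equiv
    rw [← hmap]
    exact image_mem_map (hTo.mem_nhds hzT)
  have himsa : IsSemialgebraic ℚ (Φ '' T) :=
    IsSemialgebraicMapOn.isSemialgebraic_image_holds hΦ hTS hTsa
  -- the rest of the image is null: it lies in the image of the null set `S ∖ T`
  have himnull : volume (Φ '' S \ Φ '' T) = 0 := by
    have hsub : Φ '' S \ Φ '' T ⊆ Φ '' (S \ T) := by
      rintro y ⟨⟨z, hzS, rfl⟩, hy⟩
      exact ⟨z, ⟨hzS, fun hzT => hy ⟨z, hzT, rfl⟩⟩, rfl⟩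
    refine measure_mono_null hsub ?_
    exact Summit.KontsevichZagierPeriods.KontsevichZagierPeriods.BetaCancellationLine.aeJacobian_volume_image_null
      Φ Φ' hderiv sdiff_subset
      (Literature.ModelTheory.ExponentialFields.IsSemialgebraic.measurableSet_holds hSTsa) hSTnull
  exact ⟨T, hTS, hTo, hTsa, hSTsa, hSTnull, hopen, himsa, himnull,
    isSemialgebraicMapOn_invFunOn hΦ hinj hTS hTsa, hleft, hstrict, hinv⟩

/-- **Registered sub-goal `exists_open_semialgebraic_inverse`** (crux stmt-KontsevichZagierPeriods-13633,
line `divisor-slicing-transshipment`, helper for `stub_tameForm`): inversion of a rule-(2)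
substitution off a null semialgebraic set, in the registered one-line form. [folklore] -/
theorem exists_open_semialgebraic_inverse : ∀ {d : ℕ} {S : Set (Fin d → ℝ)} {Φ : (Fin d → ℝ) → (Fin d → ℝ)} {Φ' : (Fin d → ℝ) → (Fin d → ℝ) →L[ℝ] (Fin d → ℝ)} (hS : IsSemialgebraic ℚ S) (hΦ : IsSemialgebraicMapOn ℚ S Φ) (hinj : InjOn Φ S) (hderiv : ∀ z ∈ S, HasFDerivWithinAt Φ (Φ' z) S z) (hdet : ∀ z ∈ S, (Φ' z).det ≠ 0), ∃ T : Set (Fin d → ℝ), T ⊆ S ∧ IsOpen T ∧ IsSemialgebraic ℚ T ∧ IsSemialgebraic ℚ (S \ T) ∧ volume (S \ T) = 0 ∧ IsOpen (Φ '' T) ∧ IsSemialgebraic ℚ (Φ '' T) ∧ volume (Φ '' S \ Φ '' T) = 0 ∧ IsSemialgebraicMapOn ℚ (Φ '' T) (invFunOn Φ S) ∧ (∀ z ∈ T, invFunOn Φ S (Φ z) = z) ∧ (∀ z ∈ T, HasStrictFDerivAt Φ (Φ' z) z) ∧ (∀ z (hz : z ∈ S), z ∈ T → HasStrictFDerivAt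 (invFunOn Φ S) (((Φ' z).toContinuousLinearEquivOfDetNeZero (hdet z hz)).symm : (Fin d → ℝ) →L[ℝ] (Fin d → ℝ)) (Φ z)) :=
  fun hS hΦ hinj hderiv hdet => exists_open_semialgebraic_inverse' hS hΦ hinj hderiv hdet

end Summit.KontsevichZagierPeriods.KontsevichZagierPeriods.BetaCancellationDivisorSlicing

end
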